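import Literature.MathematicalPhysics.QuantumFieldTheory.Balaban1983to89.B12Ineq417Regular

/-!
# `Balaban1983to89.B12Ineq418Regular` — [Balaban1987RG1] (4.18) p. 285 for the field `B` ITSELF at a translation-invariant
(52)-REGULAR background: the general-background twin of `B12Ineq418Flat.ineq418_flat` by the pure Cauchy route, with no displayed
analytic input

HONEST FRAMING (cell `lit-balaban`, verbatim): statement-level skeleton of published theorems with citation tags; proofs where
landed; nothing here is a claim about the Yang–Mills mass gap.

CITATION HEADER.  T. Bałaban, *Renormalization group approach to lattice gauge field theories. I*, Commun. Math. Phys. **109** (1987)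
249–301 [Balaban1987RG1] (cell paper B12; journal page = PDF page + 248), (4.18) p. 285: «For second order derivatives we have a
weaker conclusion, because we do not have bounds for second order derivatives of the field A, only for Hölder norms of first order
derivatives in (3.32). They imply the bound |(∂_λ∂_νB_μ)(x)| < α₁(L^jη)^{2+β}, 0 < β₀ ≤ β < 1, (4.18) by similar considerations as in
the proof of (4.17).»; T. Bałaban, *Averaging operations for lattice gauge theories*, Commun. Math. Phys. **98** (1985) 17–51
[Balaban1985Averaging] (cell paper B7; journal page = PDF page + 16): Proposition 2 (52) p. 26, Proposition 4 (131) p. 38 and its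
analyticity clause p. 36, (127) p. 37, locality p. 24 (after (43)).  Unit `lit-balaban-r20` gen 5 (fold owner of B12); SUPPLEMENT to
row B12.Eq4.16-4.18 (owner cell r09 `typed p243650`): the print's flat case is `B12Ineq418Flat.ineq418_flat` (p247232); the δB twins
are `B12Ineq418DeltaB` (p248455, flat / invariant-background displayed-input form) and `B12Ineq417Regular.ineq418_deltaB_regular_of_invariant`
(p249588); this file is the missing corner — (4.18) for `B` at a general translation-invariant (52)-regular background.

READING NOTE.  As for (4.17) (`B12Ineq417Regular`): the print's `Q_j` is the translation-INVARIANT flat composite; at a general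
background the composite (127) `Q_j(U₀, ·)` is translation COVARIANT (`B7TranslationCovariance.logCovIter_shiftCfg`), so second
differences of `B_μ = ζ̃·Q_{j,μ}(U₀, B)` at `x` involve `Q_j` at the translated backgrounds `t_λU₀`, `t_νU₀`, `t_λt_νU₀`.  Here the
background is assumed INVARIANT under `t_λ = t_{L^je_λ}` and `t_ν = t_{L^je_ν}` (e.g. the print's `U₀ = 1`, constant backgrounds, any
`L^j`-periodic background in the two directions), so that all four values of `Q_{j,μ}(U₀, ·)(x)` go through ONE chart
`φ(q) = Q_{j,μ}(U₀, ins q)(z)` on `𝔸^S`, `S = B^j(c₋) ∪ B^j(c₊)` (locality, `B7LocalityGeneral.logCovIter_eq_chart`).  The second-order input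
that the print takes from «Hölder norms of first order derivatives» enters as the bound `g₂` on the `(L^je_λ, e_ν)` double differences
of the fine field; the second derivative of the averaging map is replaced by the Cauchy estimate for mixed second differences of a
bounded holomorphic map (`B12Ineq418Flat.norm_secondDiff_le`), exactly as in the flat file but WITHOUT Proposition 5 of [7].

WHAT THIS FILE PROVES (kernel, 0 sorry, standard axioms; theorems only — no definition, no `def … : Prop`):
* §1 `eq418_general_split` — the product rule for the mixed second difference of `ζ̃·Q_{j,μ}(U₀, B)` (pure algebra, any background).
* §2 `norm_secondDiff_logCovIter_le`, `norm_diff_logCovIter_lam_le`, `norm_diff_logCovIter_nu_le` — at a `t_λ`-, `t_ν`-invariant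
  (52)-regular `G`-valued background (hypotheses of `B7Eq123General.prop4_general`, smallness at the polydisc radius `b₁`):
  `‖Q(z+e_λ+e_ν) − Q(z+e_λ) − Q(z+e_ν) + Q(z)‖ ≤ M·L^jg₂/ρ + M·L^jg_λ·L^jg_ν/ρ²`, `‖Q(z+e_λ+e_ν) − Q(z+e_λ)‖ ≤ M·L^jg_ν/ρ`,
  `‖Q(z+e_λ+e_ν) − Q(z+e_ν)‖ ≤ M·L^jg_λ/ρ`, `M = 2L^jb₁`, `Q = Q_{j,μ}(U₀, B)(·)`.
* §3 **`ineq418_regular_of_invariant`** — (4.18): `‖(∂_λ∂_νB_μ)(z)‖ ≤ |ζ̃(z)|·(M·L^jg₂/ρ + M·L^jg_λ·L^jg_ν/ρ²) + δ₁·M·(L^jg_λ +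
  L^jg_ν)/ρ + δ₂·2L^jb` (`δ₁` bounds the first, `δ₂` the mixed second differences of `ζ̃`).  With the DICTIONARY of `B12Ineq417Flat`
  (`b, b₁ = O(η)`, `g_· = O(η²)`, `g₂ = O(η²(L^jη)^β)`, `δ₁ = O(L^jη)`, `δ₂ = O((L^jη)²)`, `ρ = b₁/8`) every term is `O(1)(L^jη)^{2+β}`.

DIVERGENCES / NOT PROVED.  `ℤ^d`, no torus (descent: `B7AvgPeriodicity`); constants OURS; the background must be invariant under the two
translations (at a general (52)-regular background the two background-variation terms of `B7TranslationCovariance.eq416_general_split`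
and their differences would enter — not treated, not printed); the flat file's first term carries Proposition 5's operator constant
`2dL^j(1 + C₃L^jb₁)` where this file has the Cauchy constant `M/ρ`.
-/

noncomputable section

open scoped BigOperators
open Set Metric
open Literature.MathematicalPhysics.QuantumFieldTheory.Balaban1983to89
open Literature.MathematicalPhysics.QuantumFieldTheory.Balaban1983to89.B7Prop1Explicit (e)
open Literature.MathematicalPhysics.QuantumFieldTheory.Balaban1983to89.B7Prop2Explicit (pdev AvgClosed C0 c2')
open Literature.MathematicalPhysics.QuantumFieldTheory.Balaban1983to89.B7Prop3Flat (insCfg c3)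
open Literature.MathematicalPhysics.QuantumFieldTheory.Balaban1983to89.B7Prop5Flat (restr)
open Literature.MathematicalPhysics.QuantumFieldTheory.Balaban1983to89.B7Prop4GeneralLevels (logCovIter)
open Literature.MathematicalPhysics.QuantumFieldTheory.Balaban1983to89.B12Ineq417Flat (shiftCfg shiftCfg_apply shiftCfg_zero
  shiftCfg_shiftCfg boxBonds)
open Literature.MathematicalPhysics.QuantumFieldTheory.Balaban1983to89.B12Ineq418Flat (norm_secondDiff_le dd2Cfg)
open Literature.MathematicalPhysics.QuantumFieldTheory.Balaban1983to89.B7TranslationCovariance (locBG dlocBG logCovIter_shiftCfg)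
open Literature.MathematicalPhysics.QuantumFieldTheory.Balaban1983to89.B12Ineq417General (norm_sub_le_of_chart norm_restr_le
  norm_restr_shift_sub_le)
open Literature.MathematicalPhysics.QuantumFieldTheory.Balaban1983to89.B12Ineq418DeltaB (norm_restr_dd2Cfg_le restr_shift2_eq)
open Literature.MathematicalPhysics.QuantumFieldTheory.Balaban1983to89.B7LocalityGeneral (logCovIter_eq_chart)
open Literature.MathematicalPhysics.QuantumFieldTheory.Balaban1983to89.B7Eq123General (prop4_general)
open Literature.MathematicalPhysics.QuantumFieldTheory.Balaban1983to89.B12Ineq417Regular (smallness_mono analyticOnNhd_logCovIter_ins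
  norm_logCovIter_ins_le)

namespace Literature.MathematicalPhysics.QuantumFieldTheory.Balaban1983to89.B12Ineq418Regular

variable {d : ℕ}

/-! ## §1 The product rule for the mixed second difference of `ζ̃·Q_{j,μ}(U₀, B)` -/

section Algebra

variable {𝔸 : Type*} [NormedRing 𝔸] [NormedAlgebra ℂ 𝔸] [CompleteSpace 𝔸]

/-- **Product rule for the mixed second difference** of `B_μ = ζ̃·Q`, `Q = Q_{j,μ}(U₀, B)(·)` at ANY background (the general-background
twin of `B12Ineq418Flat.eq418_split`): `Δ_λΔ_ν(ζ̃Q)(z) = ζ̃(z)·[Q(z+e_λ+e_ν) − Q(z+e_λ) − Q(z+e_ν) + Q(z)]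
+ [ζ̃(z+e_λ) − ζ̃(z)]·[Q(z+e_λ+e_ν) − Q(z+e_λ)] + [ζ̃(z+e_ν) − ζ̃(z)]·[Q(z+e_λ+e_ν) − Q(z+e_ν)]
+ [ζ̃(z+e_λ+e_ν) − ζ̃(z+e_λ) − ζ̃(z+e_ν) + ζ̃(z)]·Q(z+e_λ+e_ν)`. [cite: Balaban1987RG1, (4.18) p.285, (4.16) p.285] (elementary algebra; our proof) -/
theorem eq418_general_split (ζ : B7Prop1Explicit.Site d → ℝ) (L : ℕ) (U₀ : B7Prop1Explicit.Site d → Fin d → 𝔸ˣ)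
    (B : B7Prop1Explicit.Site d → Fin d → 𝔸) (j : ℕ) (lam ν : Fin d) (z : B7Prop1Explicit.Site d) (μ : Fin d) :
    dlocBG ζ L U₀ B j ν (z + e lam) μ - dlocBG ζ L U₀ B j ν z μ
      = ζ z • (logCovIter L U₀ B j (z + e lam + e ν) μ - logCovIter L U₀ B j (z + e lam) μ
          - logCovIter L U₀ B j (z + e ν) μ + logCovIter L U₀ B j z μ)
        + (ζ (z + e lam) - ζ z) • (logCovIter L U₀ B j (z + e lam + e ν) μ - logCovIter L U₀ B j (z + e lam) μ)
        + (ζ (z + e ν) - ζ z) • (logCovIter L U₀ B j (z + e lam + e ν) μ - logCovIter L U₀ B j (z + e ν) μ)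
        + (ζ (z + e lam + e ν) - ζ (z + e lam) - ζ (z + e ν) + ζ z) • logCovIter L U₀ B j (z + e lam + e ν) μ := by
  simp only [dlocBG, locBG]
  module

end Algebra

/-! ## §2 Second and first differences of `Q_{j,μ}(U₀, B)` at a `t_λ`-, `t_ν`-invariant (52)-regular background -/

section Differences

variable {𝔸 : Type*} [NormedRing 𝔸] [NormedAlgebra ℂ 𝔸] [CompleteSpace 𝔸] [NormOneClass 𝔸]

/-- **THE MIXED SECOND DIFFERENCE OF `Q_{j,μ}(U₀, B)` AT A `t_λ`-, `t_ν`-INVARIANT (52)-REGULAR BACKGROUND.**  Data: `L ≥ 2`; `U₀`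
`G`-valued (`AvgClosed`) with `pdev U₀ < α₀L^{−2k}`, `C₀α₀ ≤ ⅓`, `4α₀ ≤ c₂′(d, L)`, `t_{L^je_λ}U₀ = U₀ = t_{L^je_ν}U₀`; a level `j ≤ k`;
the Prop.-4 smallness at the polydisc radius `b₁`; `sup ‖B‖ ≤ b`, fine `λ`/`ν`-differences of `B` `≤ g_λ, g_ν`, its `(L^je_λ, e_ν)`
double differences `≤ g₂`; `ρ > 0` with `b + L^jg_λ + L^jg_ν + L^jg₂ + 2ρ ≤ b₁`.  CONCLUSION, with `M = 2L^jb₁` and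
`Q = Q_{j,μ}(U₀, B)(·)`: `‖Q(z+e_λ+e_ν) − Q(z+e_λ) − Q(z+e_ν) + Q(z)‖ ≤ M·L^jg₂/ρ + M·(L^jg_λ)(L^jg_ν)/ρ²` — through the chart
`φ(q) = Q_{j,μ}(U₀, ins q)(z)` the four values are `φ(p+V+W+Z), φ(p+V), φ(p+W), φ(p)`; the `Z`-correction is a first-order Cauchy
estimate, the rest a mixed second difference of the bounded holomorphic `φ`. [cite: Balaban1987RG1, (4.18) p.285; Balaban1985Averaging, Prop. 4 (131) p.38, (127) p.37, (52) p.26, p.24] -/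
theorem norm_secondDiff_logCovIter_le (L : ℕ) (hL : 2 ≤ L) {G : Subgroup 𝔸ˣ} (hG : AvgClosed d L G)
    (k : ℕ) (U₀ : B7Prop1Explicit.Site d → Fin d → 𝔸ˣ) (hU₀ : ∀ x κ, U₀ x κ ∈ G) {α₀ : ℝ} (hα : 0 < α₀)
    (hα3 : C0 d * α₀ ≤ 1 / 3) (hα4 : 4 * α₀ ≤ c2' d L) (h52 : pdev U₀ < α₀ * (((L : ℝ) ^ k)⁻¹) ^ 2)
    (B : B7Prop1Explicit.Site d → Fin d → 𝔸) {j : ℕ} (hj : j ≤ k) (lam nu : Fin d)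
    (hUL : shiftCfg (((L : ℤ) ^ j) • e lam) U₀ = U₀) (hUN : shiftCfg (((L : ℤ) ^ j) • e nu) U₀ = U₀)
    (z : B7Prop1Explicit.Site d) (μ : Fin d) {b b₁ gL gN g₂ ρ : ℝ}
    (hsmall : Real.exp (4 * (800 * ((d : ℝ) + 1) ^ 2 * ((d : ℝ) + 4)) * α₀)
      * (1 + 8 * (131072 * ((d : ℝ) + 1) ^ 2) * ((L : ℝ) ^ k * b₁)) ≤ 2)
    (hc₃ : 2 * ((L : ℝ) ^ k * b₁) ≤ c3 d L)
    (hb : 0 ≤ b) (hB : ∀ x κ, ‖B x κ‖ ≤ b)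
    (hgL0 : 0 ≤ gL) (hgL : ∀ x κ, ‖B (x + e lam) κ - B x κ‖ ≤ gL)
    (hgN0 : 0 ≤ gN) (hgN : ∀ x κ, ‖B (x + e nu) κ - B x κ‖ ≤ gN)
    (hg₂0 : 0 ≤ g₂) (hG2 : ∀ y κ, ‖(B (y + ((L : ℤ) ^ j) • e lam + e nu) κ - B (y + ((L : ℤ) ^ j) • e lam) κ)
      - (B (y + e nu) κ - B y κ)‖ ≤ g₂)
    (hρ : 0 < ρ) (hroom : b + (L : ℝ) ^ j * gL + (L : ℝ) ^ j * gN + (L : ℝ) ^ j * g₂ + 2 * ρ ≤ b₁) :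
    ‖logCovIter L U₀ B j (z + e lam + e nu) μ - logCovIter L U₀ B j (z + e lam) μ
        - logCovIter L U₀ B j (z + e nu) μ + logCovIter L U₀ B j z μ‖
      ≤ 2 * ((L : ℝ) ^ j * b₁) * ((L : ℝ) ^ j * g₂) / ρ
        + 2 * ((L : ℝ) ^ j * b₁) * ((L : ℝ) ^ j * gL) * ((L : ℝ) ^ j * gN) / ρ ^ 2 := by
  have hL1 : 1 ≤ L := le_trans (by norm_num) hL
  set S := boxBonds L j z μ with hS
  set aL : B7Prop1Explicit.Site d := ((L : ℤ) ^ j) • e lam with haL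
  set aN : B7Prop1Explicit.Site d := ((L : ℤ) ^ j) • e nu with haN
  have hLj : (0 : ℝ) ≤ (L : ℝ) ^ j := by positivity
  have hLgL : (0 : ℝ) ≤ (L : ℝ) ^ j * gL := by positivity
  have hLgN : (0 : ℝ) ≤ (L : ℝ) ^ j * gN := by positivity
  have hLg2 : (0 : ℝ) ≤ (L : ℝ) ^ j * g₂ := by positivity
  have hb₁ : b ≤ b₁ := by linarith
  have hb₁0 : 0 ≤ b₁ := le_trans hb hb₁
  set M : ℝ := 2 * ((L : ℝ) ^ j * b₁) with hMdef
  have hM0 : 0 ≤ M := by positivity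
  -- the chart at `U₀` and its analytic data (B12Ineq417Regular §3 at `a = 0`)
  set φ : (S → 𝔸) → 𝔸 := fun q => logCovIter L U₀ (insCfg S q) j z μ with hφdef
  have hchart : ∀ G' : B7Prop1Explicit.Site d → Fin d → 𝔸, logCovIter L U₀ G' j z μ = φ (restr S G') := fun G' => by
    rw [hφdef]; exact logCovIter_eq_chart L hL1 U₀ G' j z μ
  have hφa : AnalyticOnNhd ℂ φ (ball 0 b₁) := by
    have h := analyticOnNhd_logCovIter_ins S L hL hG k U₀ hU₀ hα hα3 hα4 h52 hsmall hc₃ 0 hj z μ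
    simpa only [shiftCfg_zero] using h
  have hφd : DifferentiableOn ℂ φ (ball 0 b₁) := hφa.differentiableOn
  have hM : ∀ q ∈ ball (0 : S → 𝔸) b₁, ‖φ q‖ ≤ M := by
    have h := norm_logCovIter_ins_le S L hL hG k U₀ hU₀ hα hα3 hα4 h52 hb₁0 hsmall hc₃ 0 hj z μ
    simpa only [shiftCfg_zero] using h
  -- invariance of the background under the composite translation
  have hULN : shiftCfg (aL + aN) U₀ = U₀ := by rw [← shiftCfg_shiftCfg, hUN, hUL]
  -- covariance: the four values of `Q` through the one chart at `U₀`
  have c11 : logCovIter L U₀ B j (z + e lam + e nu) μ = φ (restr S (shiftCfg (aL + aN) B)) := by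
    rw [add_assoc, logCovIter_shiftCfg, smul_add, ← haL, ← haN, hULN, hchart]
  have c10 : logCovIter L U₀ B j (z + e lam) μ = φ (restr S (shiftCfg aL B)) := by
    rw [logCovIter_shiftCfg, ← haL, hUL, hchart]
  have c01 : logCovIter L U₀ B j (z + e nu) μ = φ (restr S (shiftCfg aN B)) := by
    rw [logCovIter_shiftCfg, ← haN, hUN, hchart]
  have c00 : logCovIter L U₀ B j z μ = φ (restr S B) := hchart B
  -- the restricted data
  set p : S → 𝔸 := restr S B with hp
  set V : S → 𝔸 := restr S (shiftCfg aL B) - restr S B with hV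
  set W : S → 𝔸 := restr S (shiftCfg aN B) - restr S B with hW
  set Z : S → 𝔸 := restr S (dd2Cfg aL aN B) with hZ
  have hq10 : restr S (shiftCfg aL B) = p + V := by rw [hp, hV]; abel
  have hq01 : restr S (shiftCfg aN B) = p + W := by rw [hp, hW]; abel
  have hq11 : restr S (shiftCfg (aL + aN) B) = p + V + W + Z := by rw [restr_shift2_eq, hp, hV, hW, hZ]
  -- sizes
  have hpn : ‖p‖ ≤ b := norm_restr_le S B hb hB
  have hVn : ‖V‖ ≤ (L : ℝ) ^ j * gL := norm_restr_shift_sub_le S B L j lam hgL0 hgL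
  have hWn : ‖W‖ ≤ (L : ℝ) ^ j * gN := norm_restr_shift_sub_le S B L j nu hgN0 hgN
  have hZn : ‖Z‖ ≤ (L : ℝ) ^ j * g₂ := norm_restr_dd2Cfg_le S aL B L j nu hg₂0 hG2
  -- (a) the Z-correction by the first-order Cauchy estimate
  have hIa : ‖φ (p + V + W + Z) - φ (p + V + W)‖ ≤ M * ((L : ℝ) ^ j * g₂) / ρ := by
    have hroomIa : ‖p + V + W‖ + ‖Z‖ + ρ ≤ b₁ := by
      have : ‖p + V + W‖ ≤ b + (L : ℝ) ^ j * gL + (L : ℝ) ^ j * gN :=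
        le_trans (norm_add_le _ _) (add_le_add (le_trans (norm_add_le _ _) (add_le_add hpn hVn)) hWn)
      linarith
    calc ‖φ (p + V + W + Z) - φ (p + V + W)‖ ≤ M * ‖Z‖ / ρ := norm_sub_le_of_chart hφd hM hρ (p + V + W) Z hroomIa
      _ ≤ M * ((L : ℝ) ^ j * g₂) / ρ := div_le_div_of_nonneg_right (mul_le_mul_of_nonneg_left hZn hM0) hρ.le
  -- (b) the pure mixed second difference by the second-order Cauchy estimate
  have hIb : ‖φ (p + V + W) - φ (p + V) - φ (p + W) + φ p‖
      ≤ M * ((L : ℝ) ^ j * gL) * ((L : ℝ) ^ j * gN) / ρ ^ 2 := by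
    have hmem : ∀ s t : ℂ, ‖s‖ * ‖V‖ < ‖V‖ + ρ → ‖t‖ * ‖W‖ < ‖W‖ + ρ → p + s • V + t • W ∈ ball (0 : S → 𝔸) b₁ := by
      intro s t hs ht
      rw [mem_ball_zero_iff]
      calc ‖p + s • V + t • W‖ ≤ ‖p‖ + ‖s • V‖ + ‖t • W‖ := norm_add₃_le
        _ = ‖p‖ + ‖s‖ * ‖V‖ + ‖t‖ * ‖W‖ := by rw [norm_smul, norm_smul]
        _ < b + ((L : ℝ) ^ j * gL + ρ) + ((L : ℝ) ^ j * gN + ρ) := by linarith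
        _ ≤ b₁ := by linarith
    calc ‖φ (p + V + W) - φ (p + V) - φ (p + W) + φ p‖ ≤ M * ‖V‖ * ‖W‖ / ρ ^ 2 :=
          norm_secondDiff_le isOpen_ball hφd hM0 hρ p V W hmem hM
      _ ≤ M * ((L : ℝ) ^ j * gL) * ((L : ℝ) ^ j * gN) / ρ ^ 2 := by
          refine div_le_div_of_nonneg_right ?_ (by positivity)
          exact mul_le_mul (mul_le_mul_of_nonneg_left hVn hM0) hWn (norm_nonneg _) (by positivity)
  -- assemble
  rw [c11, c10, c01, c00, hq11, hq10, hq01]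
  have hsplit : φ (p + V + W + Z) - φ (p + V) - φ (p + W) + φ p
      = (φ (p + V + W + Z) - φ (p + V + W)) + (φ (p + V + W) - φ (p + V) - φ (p + W) + φ p) := by abel
  rw [hsplit]
  exact (norm_add_le _ _).trans (add_le_add hIa hIb)

/-- **The `ν`-difference of `Q_{j,μ}(U₀, B)` at the translated point `z + e_λ`**, at a `t_λ`-, `t_ν`-invariant (52)-regular background:
`‖Q(z+e_λ+e_ν) − Q(z+e_λ)‖ ≤ M·L^jg_ν/ρ` (first-order Cauchy estimate through the chart between the points `(t_λB)|_S` and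
`(t_λt_νB)|_S`, whose difference is `L^j` fine `ν`-differences). [cite: Balaban1987RG1, (4.17)–(4.18) p.285; Balaban1985Averaging, Prop. 4 (131) p.38, (127) p.37] -/
theorem norm_diff_logCovIter_lam_le (L : ℕ) (hL : 2 ≤ L) {G : Subgroup 𝔸ˣ} (hG : AvgClosed d L G)
    (k : ℕ) (U₀ : B7Prop1Explicit.Site d → Fin d → 𝔸ˣ) (hU₀ : ∀ x κ, U₀ x κ ∈ G) {α₀ : ℝ} (hα : 0 < α₀)
    (hα3 : C0 d * α₀ ≤ 1 / 3) (hα4 : 4 * α₀ ≤ c2' d L) (h52 : pdev U₀ < α₀ * (((L : ℝ) ^ k)⁻¹) ^ 2)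
    (B : B7Prop1Explicit.Site d → Fin d → 𝔸) {j : ℕ} (hj : j ≤ k) (lam nu : Fin d)
    (hUL : shiftCfg (((L : ℤ) ^ j) • e lam) U₀ = U₀) (hUN : shiftCfg (((L : ℤ) ^ j) • e nu) U₀ = U₀)
    (z : B7Prop1Explicit.Site d) (μ : Fin d) {b b₁ gN ρ : ℝ}
    (hsmall : Real.exp (4 * (800 * ((d : ℝ) + 1) ^ 2 * ((d : ℝ) + 4)) * α₀)
      * (1 + 8 * (131072 * ((d : ℝ) + 1) ^ 2) * ((L : ℝ) ^ k * b₁)) ≤ 2)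
    (hc₃ : 2 * ((L : ℝ) ^ k * b₁) ≤ c3 d L)
    (hb : 0 ≤ b) (hB : ∀ x κ, ‖B x κ‖ ≤ b)
    (hgN0 : 0 ≤ gN) (hgN : ∀ x κ, ‖B (x + e nu) κ - B x κ‖ ≤ gN)
    (hρ : 0 < ρ) (hroom : b + (L : ℝ) ^ j * gN + ρ ≤ b₁) :
    ‖logCovIter L U₀ B j (z + e lam + e nu) μ - logCovIter L U₀ B j (z + e lam) μ‖
      ≤ 2 * ((L : ℝ) ^ j * b₁) * ((L : ℝ) ^ j * gN) / ρ := by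
  have hL1 : 1 ≤ L := le_trans (by norm_num) hL
  set S := boxBonds L j z μ with hS
  set aL : B7Prop1Explicit.Site d := ((L : ℤ) ^ j) • e lam with haL
  set aN : B7Prop1Explicit.Site d := ((L : ℤ) ^ j) • e nu with haN
  have hLgN : (0 : ℝ) ≤ (L : ℝ) ^ j * gN := by positivity
  have hb₁0 : 0 ≤ b₁ := by linarith
  set M : ℝ := 2 * ((L : ℝ) ^ j * b₁) with hMdef
  have hM0 : 0 ≤ M := by positivity
  set φ : (S → 𝔸) → 𝔸 := fun q => logCovIter L U₀ (insCfg S q) j z μ with hφdef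
  have hchart : ∀ G' : B7Prop1Explicit.Site d → Fin d → 𝔸, logCovIter L U₀ G' j z μ = φ (restr S G') := fun G' => by
    rw [hφdef]; exact logCovIter_eq_chart L hL1 U₀ G' j z μ
  have hφa : AnalyticOnNhd ℂ φ (ball 0 b₁) := by
    have h := analyticOnNhd_logCovIter_ins S L hL hG k U₀ hU₀ hα hα3 hα4 h52 hsmall hc₃ 0 hj z μ
    simpa only [shiftCfg_zero] using h
  have hM : ∀ q ∈ ball (0 : S → 𝔸) b₁, ‖φ q‖ ≤ M := by
    have h := norm_logCovIter_ins_le S L hL hG k U₀ hU₀ hα hα3 hα4 h52 hb₁0 hsmall hc₃ 0 hj z μ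
    simpa only [shiftCfg_zero] using h
  have hULN : shiftCfg (aL + aN) U₀ = U₀ := by rw [← shiftCfg_shiftCfg, hUN, hUL]
  have c11 : logCovIter L U₀ B j (z + e lam + e nu) μ = φ (restr S (shiftCfg (aL + aN) B)) := by
    rw [add_assoc, logCovIter_shiftCfg, smul_add, ← haL, ← haN, hULN, hchart]
  have c10 : logCovIter L U₀ B j (z + e lam) μ = φ (restr S (shiftCfg aL B)) := by
    rw [logCovIter_shiftCfg, ← haL, hUL, hchart]
  -- the two points: `q = (t_λB)|_S`, `q + w = (t_νt_λB)|_S`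
  set q : S → 𝔸 := restr S (shiftCfg aL B) with hq
  set w : S → 𝔸 := restr S (shiftCfg (aL + aN) B) - restr S (shiftCfg aL B) with hw
  have hqw : restr S (shiftCfg (aL + aN) B) = q + w := by rw [hq, hw]; abel
  have hqn : ‖q‖ ≤ b := norm_restr_le S _ hb fun x κ => by simpa [shiftCfg] using hB (x + aL) κ
  have hwn : ‖w‖ ≤ (L : ℝ) ^ j * gN := by
    rw [hw, add_comm aL aN, ← shiftCfg_shiftCfg]
    exact norm_restr_shift_sub_le S (shiftCfg aL B) L j nu hgN0 fun x κ => by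
      simpa [shiftCfg, add_right_comm x (e nu) aL] using hgN (x + aL) κ
  have hroom' : ‖q‖ + ‖w‖ + ρ ≤ b₁ := by linarith
  rw [c11, c10, hqw]
  calc ‖φ (q + w) - φ q‖ ≤ M * ‖w‖ / ρ := norm_sub_le_of_chart hφa.differentiableOn hM hρ q w hroom'
    _ ≤ M * ((L : ℝ) ^ j * gN) / ρ := div_le_div_of_nonneg_right (mul_le_mul_of_nonneg_left hwn hM0) hρ.le

/-- **The `λ`-difference of `Q_{j,μ}(U₀, B)` at the translated point `z + e_ν`** (the symmetric statement):
`‖Q(z+e_λ+e_ν) − Q(z+e_ν)‖ ≤ M·L^jg_λ/ρ`. [cite: Balaban1987RG1, (4.17)–(4.18) p.285; Balaban1985Averaging, Prop. 4 (131) p.38, (127) p.37] -/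
theorem norm_diff_logCovIter_nu_le (L : ℕ) (hL : 2 ≤ L) {G : Subgroup 𝔸ˣ} (hG : AvgClosed d L G)
    (k : ℕ) (U₀ : B7Prop1Explicit.Site d → Fin d → 𝔸ˣ) (hU₀ : ∀ x κ, U₀ x κ ∈ G) {α₀ : ℝ} (hα : 0 < α₀)
    (hα3 : C0 d * α₀ ≤ 1 / 3) (hα4 : 4 * α₀ ≤ c2' d L) (h52 : pdev U₀ < α₀ * (((L : ℝ) ^ k)⁻¹) ^ 2)
    (B : B7Prop1Explicit.Site d → Fin d → 𝔸) {j : ℕ} (hj : j ≤ k) (lam nu : Fin d)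
    (hUL : shiftCfg (((L : ℤ) ^ j) • e lam) U₀ = U₀) (hUN : shiftCfg (((L : ℤ) ^ j) • e nu) U₀ = U₀)
    (z : B7Prop1Explicit.Site d) (μ : Fin d) {b b₁ gL ρ : ℝ}
    (hsmall : Real.exp (4 * (800 * ((d : ℝ) + 1) ^ 2 * ((d : ℝ) + 4)) * α₀)
      * (1 + 8 * (131072 * ((d : ℝ) + 1) ^ 2) * ((L : ℝ) ^ k * b₁)) ≤ 2)
    (hc₃ : 2 * ((L : ℝ) ^ k * b₁) ≤ c3 d L)
    (hb : 0 ≤ b) (hB : ∀ x κ, ‖B x κ‖ ≤ b)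
    (hgL0 : 0 ≤ gL) (hgL : ∀ x κ, ‖B (x + e lam) κ - B x κ‖ ≤ gL)
    (hρ : 0 < ρ) (hroom : b + (L : ℝ) ^ j * gL + ρ ≤ b₁) :
    ‖logCovIter L U₀ B j (z + e lam + e nu) μ - logCovIter L U₀ B j (z + e nu) μ‖
      ≤ 2 * ((L : ℝ) ^ j * b₁) * ((L : ℝ) ^ j * gL) / ρ := by
  have h := norm_diff_logCovIter_lam_le L hL hG k U₀ hU₀ hα hα3 hα4 h52 B hj nu lam hUN hUL z μ hsmall hc₃ hb hB
    hgL0 hgL hρ hroom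
  rwa [add_right_comm] at h

end Differences

/-! ## §3 (4.18) for `B` at a `t_λ`-, `t_ν`-invariant (52)-regular background -/

section Ineq418

variable {𝔸 : Type*} [NormedRing 𝔸] [NormedAlgebra ℂ 𝔸] [CompleteSpace 𝔸] [NormOneClass 𝔸]

/-- **(4.18) AT A `t_λ`-, `t_ν`-INVARIANT (52)-REGULAR BACKGROUND** («|(∂_λ∂_νB_μ)(x)| < α₁(L^jη)^{2+β} … by similar
considerations as in the proof of (4.17)», p. 285).  Data: `L ≥ 2`; `U₀` `G`-valued (`AvgClosed`) with `pdev U₀ < α₀L^{−2k}`,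
`C₀α₀ ≤ ⅓`, `4α₀ ≤ c₂′(d, L)`, `t_{L^je_λ}U₀ = U₀ = t_{L^je_ν}U₀`; a level `j ≤ k`; the Prop.-4 smallness at the polydisc radius `b₁`;
`sup ‖B‖ ≤ b`, fine `λ`/`ν`-differences `≤ g_λ, g_ν`, `(L^je_λ, e_ν)` double differences `≤ g₂` (the Hölder input of (3.32)); the
cut-off: `|ζ̃(z+e_λ) − ζ̃(z)|, |ζ̃(z+e_ν) − ζ̃(z)| ≤ δ₁`, `|ζ̃(z+e_λ+e_ν) − ζ̃(z+e_λ) − ζ̃(z+e_ν) + ζ̃(z)| ≤ δ₂`; margin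
`b + L^jg_λ + L^jg_ν + L^jg₂ + 2ρ ≤ b₁`.  CONCLUSION, with `M = 2L^jb₁`:
`‖(∂_λ∂_νB_μ)(z)‖ ≤ |ζ̃(z)|·(M·L^jg₂/ρ + M·L^jg_λ·L^jg_ν/ρ²) + δ₁·(M·L^jg_ν/ρ + M·L^jg_λ/ρ) + δ₂·2L^jb` — §1 + §2 + (131) at `U₀`
(`B7Eq123General.prop4_general`).  At `U₀ = 1` compare `B12Ineq418Flat.ineq418_flat` (Proposition-5 constant in the first term).
[cite: Balaban1987RG1, (4.18) p.285, (3.32) p.277; Balaban1985Averaging, Prop. 4 (131) p.38, (52) p.26, (127) p.37] -/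
theorem ineq418_regular_of_invariant (ζ : B7Prop1Explicit.Site d → ℝ) (L : ℕ) (hL : 2 ≤ L) {G : Subgroup 𝔸ˣ}
    (hG : AvgClosed d L G) (k : ℕ) (U₀ : B7Prop1Explicit.Site d → Fin d → 𝔸ˣ) (hU₀ : ∀ x κ, U₀ x κ ∈ G) {α₀ : ℝ}
    (hα : 0 < α₀) (hα3 : C0 d * α₀ ≤ 1 / 3) (hα4 : 4 * α₀ ≤ c2' d L) (h52 : pdev U₀ < α₀ * (((L : ℝ) ^ k)⁻¹) ^ 2)
    (B : B7Prop1Explicit.Site d → Fin d → 𝔸) {j : ℕ} (hj : j ≤ k) (lam nu : Fin d)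
    (hUL : shiftCfg (((L : ℤ) ^ j) • e lam) U₀ = U₀) (hUN : shiftCfg (((L : ℤ) ^ j) • e nu) U₀ = U₀)
    (z : B7Prop1Explicit.Site d) (μ : Fin d) {b b₁ gL gN g₂ ρ δ₁ δ₂ : ℝ}
    (hsmall : Real.exp (4 * (800 * ((d : ℝ) + 1) ^ 2 * ((d : ℝ) + 4)) * α₀)
      * (1 + 8 * (131072 * ((d : ℝ) + 1) ^ 2) * ((L : ℝ) ^ k * b₁)) ≤ 2)
    (hc₃ : 2 * ((L : ℝ) ^ k * b₁) ≤ c3 d L)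
    (hb : 0 ≤ b) (hB : ∀ x κ, ‖B x κ‖ ≤ b)
    (hgL0 : 0 ≤ gL) (hgL : ∀ x κ, ‖B (x + e lam) κ - B x κ‖ ≤ gL)
    (hgN0 : 0 ≤ gN) (hgN : ∀ x κ, ‖B (x + e nu) κ - B x κ‖ ≤ gN)
    (hg₂0 : 0 ≤ g₂) (hG2 : ∀ y κ, ‖(B (y + ((L : ℤ) ^ j) • e lam + e nu) κ - B (y + ((L : ℤ) ^ j) • e lam) κ)
      - (B (y + e nu) κ - B y κ)‖ ≤ g₂)
    (hζL : |ζ (z + e lam) - ζ z| ≤ δ₁) (hζN : |ζ (z + e nu) - ζ z| ≤ δ₁)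
    (hζ2 : |ζ (z + e lam + e nu) - ζ (z + e lam) - ζ (z + e nu) + ζ z| ≤ δ₂)
    (hρ : 0 < ρ) (hroom : b + (L : ℝ) ^ j * gL + (L : ℝ) ^ j * gN + (L : ℝ) ^ j * g₂ + 2 * ρ ≤ b₁) :
    ‖dlocBG ζ L U₀ B j nu (z + e lam) μ - dlocBG ζ L U₀ B j nu z μ‖
      ≤ |ζ z| * (2 * ((L : ℝ) ^ j * b₁) * ((L : ℝ) ^ j * g₂) / ρ
            + 2 * ((L : ℝ) ^ j * b₁) * ((L : ℝ) ^ j * gL) * ((L : ℝ) ^ j * gN) / ρ ^ 2)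
        + δ₁ * (2 * ((L : ℝ) ^ j * b₁) * ((L : ℝ) ^ j * gN) / ρ + 2 * ((L : ℝ) ^ j * b₁) * ((L : ℝ) ^ j * gL) / ρ)
        + δ₂ * (2 * ((L : ℝ) ^ j * b)) := by
  have hδ₁ : 0 ≤ δ₁ := le_trans (abs_nonneg _) hζL
  have hδ₂ : 0 ≤ δ₂ := le_trans (abs_nonneg _) hζ2
  have hLg2 : (0 : ℝ) ≤ (L : ℝ) ^ j * g₂ := by positivity
  have hb₁ : b ≤ b₁ := by
    have h1 : (0 : ℝ) ≤ (L : ℝ) ^ j * gL := by positivity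
    have h2 : (0 : ℝ) ≤ (L : ℝ) ^ j * gN := by positivity
    linarith
  obtain ⟨hsmall_b, hc₃_b⟩ := smallness_mono (d := d) (L := L) (k := k) (α₀ := α₀) hb₁ hsmall hc₃
  -- the four pieces
  have h2nd := norm_secondDiff_logCovIter_le L hL hG k U₀ hU₀ hα hα3 hα4 h52 B hj lam nu hUL hUN z μ hsmall hc₃ hb hB
    hgL0 hgL hgN0 hgN hg₂0 hG2 hρ hroom
  have hLgL : (0 : ℝ) ≤ (L : ℝ) ^ j * gL := by positivity
  have hLgN : (0 : ℝ) ≤ (L : ℝ) ^ j * gN := by positivity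
  have hdL := norm_diff_logCovIter_lam_le L hL hG k U₀ hU₀ hα hα3 hα4 h52 B hj lam nu hUL hUN z μ hsmall hc₃ hb hB
    hgN0 hgN hρ (by linarith)
  have hdN := norm_diff_logCovIter_nu_le L hL hG k U₀ hU₀ hα hα3 hα4 h52 B hj lam nu hUL hUN z μ hsmall hc₃ hb hB
    hgL0 hgL hρ (by linarith)
  have hQ : ‖logCovIter L U₀ B j (z + e lam + e nu) μ‖ ≤ 2 * ((L : ℝ) ^ j * b) :=
    (prop4_general L hL hG k U₀ hU₀ hα hα3 hα4 h52 B hb hB hsmall_b hc₃_b j hj).2 _ _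
  -- assemble through the product rule
  rw [eq418_general_split]
  have hn4 : ∀ a₁ a₂ a₃ a₄ : 𝔸, ‖a₁ + a₂ + a₃ + a₄‖ ≤ ‖a₁‖ + ‖a₂‖ + ‖a₃‖ + ‖a₄‖ := fun a₁ a₂ a₃ a₄ =>
    le_trans (norm_add_le _ _) (add_le_add norm_add₃_le le_rfl)
  refine le_trans (hn4 _ _ _ _) ?_
  have t1 := mul_le_mul_of_nonneg_left h2nd (abs_nonneg (ζ z))
  have t2 := mul_le_mul hζL hdL (norm_nonneg _) hδ₁
  have t3 := mul_le_mul hζN hdN (norm_nonneg _) hδ₁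
  have t4 := mul_le_mul hζ2 hQ (norm_nonneg _) hδ₂
  rw [norm_smul, norm_smul, norm_smul, norm_smul, Real.norm_eq_abs, Real.norm_eq_abs, Real.norm_eq_abs, Real.norm_eq_abs]
  have hsum := add_le_add (add_le_add (add_le_add t1 t2) t3) t4
  refine le_trans hsum (le_of_eq ?_)
  ring

end Ineq418

end Literature.MathematicalPhysics.QuantumFieldTheory.Balaban1983to89.B12Ineq418Regular

end
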